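import Mathlib.Analysis.Calculus.FDeriv.Symmetric
import Mathlib.Analysis.Calculus.ContDiff.FiniteDimension
import Mathlib.Analysis.Calculus.ContDiff.Operations
import Mathlib.Analysis.Calculus.FDeriv.Mul
import Mathlib.Analysis.Calculus.FDeriv.CompCLM
import Mathlib.Analysis.Normed.Operator.Bilinear
import Mathlib.LinearAlgebra.Trace
import Mathlib.Topology.Algebra.Module.FiniteDimension
import HarnessLib

/-!
# Curvature of a pseudo-Riemannian metric from its components: coordinate tensor calculus

Pure Fréchet calculus on a finite-dimensional real normed space `E` (no manifolds). The datum
is a field of bilinear forms `G : E → (E →L[ℝ] E →L[ℝ] ℝ)` — the components of a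
pseudo-Riemannian metric in a chart — which on an open set `V` is smooth, symmetric and
nondegenerate (`IsMetricOn G V`). From `G` alone we build, at a point `x`,

* `sharpAt G x = (G x)⁻¹ : E* → E` (index raising), `koszulCLM G x` (the Koszul form
  `K(X,Y,Z) = ∂_X G(Y,Z) + ∂_Y G(Z,X) − ∂_Z G(X,Y)` as a trilinear map) and the **Christoffel map**
  `chrAt G x : E →L E →L E`, `Γ(X,Y) = ♯(½ K(X,Y,·))` (O'Neill 1983, Ch. 3, Prop. 3.13:
  `Γ^k_{ij} = ½ g^{km}(∂_i g_{jm} + ∂_j g_{im} − ∂_m g_{ij})`);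
* the **curvature endomorphism** `riemAt G x X Y = D_XΓ_Y − D_YΓ_X + Γ_X ∘ Γ_Y − Γ_Y ∘ Γ_X`
  (`Γ_X = Γ(X, ·)`; O'Neill 1983, Ch. 3, Lemma 3.38, convention `R(X,Y) = [∇_X, ∇_Y] − ∇_{[X,Y]}`
  on constant fields), the **Ricci form** `ricAt G x (Y, Z) = tr (X ↦ R(X,Y)Z)` (Lemma 3.52) and
  the **scalar curvature** `scalAt G x = tr (♯ ∘ Ric)` (Def. 3.53);

and prove the classical identities: torsion-freeness `Γ(X,Y) = Γ(Y,X)`, metric compatibility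
`∂_X G(Y,Z) = G(Γ(X,Y),Z) + G(Y,Γ(X,Z))`, the first-kind formula for `G(R(X,Y)Z, W)`, the
symmetries of the curvature tensor (skew-symmetry in both pairs, first Bianchi identity, pair
symmetry; O'Neill 1983, Ch. 3, Prop. 3.36), symmetry of `Ric`, and the basis ("index") formulas
for `♯`, traces, `Ric` and `R`. Smoothness of all these objects in `x` is recorded.

This is the static half of the coordinate tensor calculus used to prove the evolution equation
of the scalar curvature under the Ricci flow (Topping 2006, Prop. 2.5.4) for
`Literature.Geometry.Riemannian.ricciFlow_scalarCurvature_lowerBound`; the link with the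
abstract objects of `LeviCivita.lean` / `Curvature.lean` on `U : Opens E` (`ChartCalculus.lean`,
`ChartConnection.lean`) is made in a later file. No definition of `Prop` type, no `sorry`.

## References

* B. O'Neill, *Semi-Riemannian geometry with applications to relativity*, Academic Press 1983,
  Ch. 3: Prop. 3.13 (Christoffel symbols), Lemma 3.38 (curvature in coordinates), Prop. 3.36
  (symmetries of curvature), Lemma 3.52 (Ricci), Def. 3.53 (scalar curvature), pp. 60–61
  (metric contraction). [ONeill1983]
* P. Topping, *Lectures on the Ricci flow*, LMS Lecture Note Series 325, CUP 2006, §2.1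
  (conventions). [Topping2006]
-/

noncomputable section

-- instance search on the nested operator spaces `E →L[ℝ] E →L[ℝ] E →L[ℝ] ℝ` (derivatives of the
-- metric components) needs a deeper pending depth, as in Mathlib's own build options
set_option maxSynthPendingDepth 3

open Set Filter ContinuousLinearMap Module
open scoped Topology ContDiff

namespace Literature.Geometry.Lorentzian

namespace MetricCoord

/-- `2 ≤ ∞` in `ℕ∞ω`, the exponent inequality used with `minSmoothness ℝ 2 = 2`. [folklore] -/
theorem two_le_infty : (minSmoothness ℝ 2 : ℕ∞ω) ≤ ∞ := by
  rw [minSmoothness_of_isRCLikeNormedField]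
  exact WithTop.coe_le_coe.mpr le_top

variable {E : Type*} [NormedAddCommGroup E] [NormedSpace ℝ E]

/-! ### Calculus helpers: evaluation commutes with differentiation -/

section Helpers

variable {F : Type*} [NormedAddCommGroup F] [NormedSpace ℝ F]
  {F' : Type*} [NormedAddCommGroup F'] [NormedSpace ℝ F']

/-- `∂_v (c(·) u)(x) = Dc(x)(v)(u)` for a differentiable family of continuous linear maps.
[folklore] -/
theorem hasFDerivAt_clm_apply_const {c : E → F →L[ℝ] F'} {c' : E →L[ℝ] F →L[ℝ] F'} {x : E}
    (hc : HasFDerivAt c c' x) (u : F) :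
    HasFDerivAt (fun y ↦ c y u) (c'.flip u) x := by
  have h := hc.clm_apply (hasFDerivAt_const u x)
  simpa using h

/-- `fderiv` form of `hasFDerivAt_clm_apply_const`. [folklore] -/
theorem fderiv_clm_apply_const {c : E → F →L[ℝ] F'} {x : E} (hc : DifferentiableAt ℝ c x)
    (u : F) (v : E) : fderiv ℝ (fun y ↦ c y u) x v = fderiv ℝ c x v u := by
  rw [(hasFDerivAt_clm_apply_const hc.hasFDerivAt u).fderiv]
  rfl

/-- Differentiability of `y ↦ c y u`. [folklore] -/
theorem differentiableAt_clm_apply_const {c : E → F →L[ℝ] F'} {x : E}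
    (hc : DifferentiableAt ℝ c x) (u : F) : DifferentiableAt ℝ (fun y ↦ c y u) x :=
  (hasFDerivAt_clm_apply_const hc.hasFDerivAt u).differentiableAt

end Helpers

/-! ### Smooth, symmetric, nondegenerate components on an open set -/

/-- The components `G : E → (E →L E →L ℝ)` of a pseudo-Riemannian metric on the open set
`V ⊆ E`: `G` is `C^∞` on `V`, and at every point of `V` the bilinear form `G x` is symmetric and
invertible (as a map `E → E*`; in finite dimension this is nondegeneracy,
`isInvertible_of_nondegenerate`). O'Neill 1983, Ch. 3, Def. 3.1 and Lemma 3.4 (a metric tensor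
in coordinates: `g_{ij}` smooth, symmetric, with invertible matrix). [cite: ONeill1983, Ch. 3, Def. 3.1] -/
structure IsMetricOn (G : E → E →L[ℝ] E →L[ℝ] ℝ) (V : Set E) : Prop where
  isOpen : IsOpen V
  contDiffOn : ContDiffOn ℝ ∞ G V
  symm : ∀ x ∈ V, ∀ v w : E, G x v w = G x w v
  isInvertible : ∀ x ∈ V, (G x).IsInvertible

/-- **Nondegenerate ⇒ invertible** in finite dimension: if `G₀(v, ·) = 0` forces `v = 0`, the map
`v ↦ G₀(v, ·)` from `E` to `E* = E →L ℝ` is a continuous linear isomorphism (injective between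
spaces of equal dimension). O'Neill 1983, Ch. 3, Lemma 3.4 ff. [folklore] -/
theorem isInvertible_of_nondegenerate [FiniteDimensional ℝ E] {B : E →L[ℝ] E →L[ℝ] ℝ}
    (h : ∀ v : E, (∀ w : E, B v w = 0) → v = 0) : B.IsInvertible := by
  have hinj : Function.Injective (B : E → E →L[ℝ] ℝ) := by
    intro v w hvw
    have : B (v - w) = 0 := by rw [map_sub, hvw, sub_self]
    have h0 := h (v - w) fun u ↦ by rw [this]; rfl
    exact sub_eq_zero.mp h0
  have hdim : finrank ℝ E = finrank ℝ (E →L[ℝ] ℝ) := by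
    rw [LinearEquiv.finrank_eq (LinearMap.toContinuousLinearMap (𝕜 := ℝ) (E := E)
      (F' := ℝ)).symm]
    exact (Subspace.dual_finrank_eq).symm
  have hbij : Function.Bijective (B.toLinearMap) :=
    ⟨hinj, (LinearMap.injective_iff_surjective_of_finrank_eq_finrank hdim).1 hinj⟩
  let e : E ≃ₗ[ℝ] (E →L[ℝ] ℝ) := LinearEquiv.ofBijective B.toLinearMap hbij
  refine ⟨e.toContinuousLinearEquiv, ?_⟩
  ext v w
  rfl

namespace IsMetricOn

variable {G : E → E →L[ℝ] E →L[ℝ] ℝ} {V : Set E} {x : E}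

/-- `V` is a neighbourhood of each of its points. [folklore] -/
theorem mem_nhds (hG : IsMetricOn G V) (hx : x ∈ V) : V ∈ 𝓝 x := hG.isOpen.mem_nhds hx

/-- Points near `x ∈ V` lie in `V`. [folklore] -/
theorem eventually_mem (hG : IsMetricOn G V) (hx : x ∈ V) : ∀ᶠ y in 𝓝 x, y ∈ V :=
  hG.mem_nhds hx

/-- `G` is `C^∞` at the points of `V`. [folklore] -/
theorem contDiffAt (hG : IsMetricOn G V) (hx : x ∈ V) : ContDiffAt ℝ ∞ G x :=
  (hG.contDiffOn x hx).contDiffAt (hG.mem_nhds hx)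

/-- `G` is differentiable at the points of `V`. [folklore] -/
theorem differentiableAt (hG : IsMetricOn G V) (hx : x ∈ V) : DifferentiableAt ℝ G x :=
  (hG.contDiffAt hx).differentiableAt (by simp)

/-- `DG` is `C^∞` on `V`. [folklore] -/
theorem contDiffOn_fderiv (hG : IsMetricOn G V) : ContDiffOn ℝ ∞ (fderiv ℝ G) V :=
  hG.contDiffOn.fderiv_of_isOpen hG.isOpen (by simp)

/-- `DG` is `C^∞` at the points of `V`. [folklore] -/
theorem contDiffAt_fderiv (hG : IsMetricOn G V) (hx : x ∈ V) : ContDiffAt ℝ ∞ (fderiv ℝ G) x :=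
  (hG.contDiffOn_fderiv x hx).contDiffAt (hG.mem_nhds hx)

/-- `DG` is differentiable at the points of `V`. [folklore] -/
theorem differentiableAt_fderiv (hG : IsMetricOn G V) (hx : x ∈ V) :
    DifferentiableAt ℝ (fderiv ℝ G) x :=
  (hG.contDiffAt_fderiv hx).differentiableAt (by simp)

/-- `D²G` is `C^∞` on `V`. [folklore] -/
theorem contDiffOn_fderiv_fderiv (hG : IsMetricOn G V) :
    ContDiffOn ℝ ∞ (fderiv ℝ (fderiv ℝ G)) V :=
  hG.contDiffOn_fderiv.fderiv_of_isOpen hG.isOpen (by simp)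

/-- `D²G` is differentiable at the points of `V`. [folklore] -/
theorem differentiableAt_fderiv_fderiv (hG : IsMetricOn G V) (hx : x ∈ V) :
    DifferentiableAt ℝ (fderiv ℝ (fderiv ℝ G)) x :=
  ((hG.contDiffOn_fderiv_fderiv x hx).contDiffAt (hG.mem_nhds hx)).differentiableAt (by simp)

/-- `∂_v (G(·)(Y,Z))(x) = DG(x)(v)(Y)(Z)`. [folklore] -/
theorem fderiv_apply₂ (hG : IsMetricOn G V) (hx : x ∈ V) (Y Z v : E) :
    fderiv ℝ (fun y ↦ G y Y Z) x v = fderiv ℝ G x v Y Z := by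
  have h1 : DifferentiableAt ℝ (fun y ↦ G y Y) x :=
    differentiableAt_clm_apply_const (hG.differentiableAt hx) Y
  rw [fderiv_clm_apply_const h1 Z v, fderiv_clm_apply_const (hG.differentiableAt hx) Y v]

/-- The first derivative `DG(x)(v)` is a symmetric bilinear form (symmetry of `G` near `x`).
[folklore] -/
theorem fderiv_symm (hG : IsMetricOn G V) (hx : x ∈ V) (v Y Z : E) :
    fderiv ℝ G x v Y Z = fderiv ℝ G x v Z Y := by
  rw [← hG.fderiv_apply₂ hx, ← hG.fderiv_apply₂ hx]
  have heq : (fun y ↦ G y Y Z) =ᶠ[𝓝 x] fun y ↦ G y Z Y :=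
    (hG.eventually_mem hx).mono fun y hy ↦ hG.symm y hy Y Z
  rw [heq.fderiv_eq]

/-- `∂_u (DG(·)(v)(Y)(Z))(x) = D²G(x)(u)(v)(Y)(Z)`. [folklore] -/
theorem fderiv_fderiv_apply₃ (hG : IsMetricOn G V) (hx : x ∈ V) (v Y Z u : E) :
    fderiv ℝ (fun y ↦ fderiv ℝ G y v Y Z) x u = fderiv ℝ (fderiv ℝ G) x u v Y Z := by
  have hD := hG.differentiableAt_fderiv hx
  have h1 : DifferentiableAt ℝ (fun y ↦ fderiv ℝ G y v) x := differentiableAt_clm_apply_const hD v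
  have h2 : DifferentiableAt ℝ (fun y ↦ fderiv ℝ G y v Y) x := differentiableAt_clm_apply_const h1 Y
  rw [fderiv_clm_apply_const h2 Z u, fderiv_clm_apply_const h1 Y u, fderiv_clm_apply_const hD v u]

/-- Symmetry of second derivatives: `D²G(x)(u)(v) = D²G(x)(v)(u)`. [folklore] -/
theorem fderiv_fderiv_comm (hG : IsMetricOn G V) (hx : x ∈ V) (u v : E) :
    fderiv ℝ (fderiv ℝ G) x u v = fderiv ℝ (fderiv ℝ G) x v u :=
  (hG.contDiffAt hx).isSymmSndFDerivAt two_le_infty u v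

/-- The second derivative `D²G(x)(u)(v)` is a symmetric bilinear form. [folklore] -/
theorem fderiv_fderiv_symm (hG : IsMetricOn G V) (hx : x ∈ V) (u v Y Z : E) :
    fderiv ℝ (fderiv ℝ G) x u v Y Z = fderiv ℝ (fderiv ℝ G) x u v Z Y := by
  rw [← hG.fderiv_fderiv_apply₃ hx, ← hG.fderiv_fderiv_apply₃ hx]
  have heq : (fun y ↦ fderiv ℝ G y v Y Z) =ᶠ[𝓝 x] fun y ↦ fderiv ℝ G y v Z Y :=
    (hG.eventually_mem hx).mono fun y hy ↦ hG.fderiv_symm hy v Y Z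
  rw [heq.fderiv_eq]

end IsMetricOn

/-! ### Index raising `♯ = G⁻¹` -/

section Sharp

variable (G : E → E →L[ℝ] E →L[ℝ] ℝ)

/-- **Index raising** at `x`: the inverse `♯ : E* → E` of `♭ : v ↦ G_x(v, ·)`
(`ContinuousLinearMap.inverse`, the junk value `0` where `G x` is not invertible).
O'Neill 1983, Ch. 3, p. 60 (metrically equivalent vectors and one-forms). [cite: ONeill1983, Ch. 3, p. 60] -/
def sharpAt (x : E) : (E →L[ℝ] ℝ) →L[ℝ] E :=
  (G x).inverse

variable {G} {V : Set E} {x : E}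

/-- `♭ (♯ α) = α`. [cite: ONeill1983, Ch. 3, p. 60] -/
theorem apply_sharpAt (hx : (G x).IsInvertible) (α : E →L[ℝ] ℝ) : G x (sharpAt G x α) = α :=
  hx.self_apply_inverse α

/-- `G_x(♯α, w) = α(w)`. [cite: ONeill1983, Ch. 3, p. 60] -/
theorem apply_sharpAt_apply (hx : (G x).IsInvertible) (α : E →L[ℝ] ℝ) (w : E) :
    G x (sharpAt G x α) w = α w := by
  rw [apply_sharpAt hx]

/-- `♯ (♭ v) = v`. [cite: ONeill1983, Ch. 3, p. 60] -/
theorem sharpAt_apply (hx : (G x).IsInvertible) (v : E) : sharpAt G x (G x v) = v :=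
  hx.inverse_apply_self v

/-- Characterisation of `♯`: `G_x(v, w) = α(w)` for all `w` forces `♯α = v`. [folklore] -/
theorem sharpAt_eq_of_forall (hx : (G x).IsInvertible) {α : E →L[ℝ] ℝ} {v : E}
    (h : ∀ w, G x v w = α w) : sharpAt G x α = v := by
  have : α = G x v := by ext w; exact (h w).symm
  rw [this, sharpAt_apply hx]

/-- For symmetric `G x`: `G_x(w, ♯α) = α(w)`. [folklore] -/
theorem apply_apply_sharpAt (hx : (G x).IsInvertible) (hs : ∀ v w : E, G x v w = G x w v)
    (α : E →L[ℝ] ℝ) (w : E) : G x w (sharpAt G x α) = α w := by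
  rw [hs, apply_sharpAt_apply hx]

/-- `♯` is `C^∞` on `V` (inversion of continuous linear maps is smooth at invertible maps).
[folklore] -/
theorem IsMetricOn.contDiffOn_sharpAt [CompleteSpace E] (hG : IsMetricOn G V) :
    ContDiffOn ℝ ∞ (sharpAt G) V := fun x hx ↦
  ((hG.isInvertible x hx).contDiffAt_map_inverse.comp_contDiffWithinAt x (hG.contDiffOn x hx) :)

/-- `♯` is `C^∞` at the points of `V`. [folklore] -/
theorem IsMetricOn.contDiffAt_sharpAt [CompleteSpace E] (hG : IsMetricOn G V) (hx : x ∈ V) :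
    ContDiffAt ℝ ∞ (sharpAt G) x :=
  (hG.contDiffOn_sharpAt x hx).contDiffAt (hG.mem_nhds hx)

/-- `♯` is differentiable at the points of `V`. [folklore] -/
theorem IsMetricOn.differentiableAt_sharpAt [CompleteSpace E] (hG : IsMetricOn G V)
    (hx : x ∈ V) : DifferentiableAt ℝ (sharpAt G) x :=
  (hG.contDiffAt_sharpAt hx).differentiableAt (by simp)

end Sharp

/-! ### The Koszul form and the Christoffel map -/

section Christoffel

variable (G : E → E →L[ℝ] E →L[ℝ] ℝ)

/-- Swap of the last two slots of a trilinear form, as a continuous linear operator: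
`(swap₂₃ T) X Y Z = T X Z Y`. [folklore] -/
def swap₂₃ : (E →L[ℝ] E →L[ℝ] E →L[ℝ] ℝ) →L[ℝ] (E →L[ℝ] E →L[ℝ] E →L[ℝ] ℝ) :=
  ContinuousLinearMap.compL ℝ E (E →L[ℝ] E →L[ℝ] ℝ) (E →L[ℝ] E →L[ℝ] ℝ)
    ((ContinuousLinearMap.flipₗᵢ ℝ E E ℝ).toContinuousLinearEquiv : _ →L[ℝ] _)

/-- Unfolding lemma for `swap₂₃`. [folklore] -/
@[simp]
theorem swap₂₃_apply (T : E →L[ℝ] E →L[ℝ] E →L[ℝ] ℝ) (X Y Z : E) :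
    swap₂₃ T X Y Z = T X Z Y := rfl

/-- Swap of the first two slots of a trilinear form, as a continuous linear operator:
`(swap₁₂ T) X Y Z = T Y X Z`. [folklore] -/
def swap₁₂ : (E →L[ℝ] E →L[ℝ] E →L[ℝ] ℝ) →L[ℝ] (E →L[ℝ] E →L[ℝ] E →L[ℝ] ℝ) :=
  ((ContinuousLinearMap.flipₗᵢ ℝ E E (E →L[ℝ] ℝ)).toContinuousLinearEquiv : _ →L[ℝ] _)

/-- Unfolding lemma for `swap₁₂`. [folklore] -/
@[simp]
theorem swap₁₂_apply (T : E →L[ℝ] E →L[ℝ] E →L[ℝ] ℝ) (X Y Z : E) :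
    swap₁₂ T X Y Z = T Y X Z := rfl

/-- The **Koszul operator** on trilinear forms: `(koszulOp T) X Y Z = T X Y Z + T Y Z X − T Z X Y`.
With `T = DG(x)` (`T X Y Z = ∂_X G(Y,Z)`) this is the Koszul form of the components.
[cite: ONeill1983, Ch. 3, Prop. 3.13] -/
def koszulOp : (E →L[ℝ] E →L[ℝ] E →L[ℝ] ℝ) →L[ℝ] (E →L[ℝ] E →L[ℝ] E →L[ℝ] ℝ) :=
  ContinuousLinearMap.id ℝ _ + swap₁₂.comp swap₂₃ - swap₂₃.comp swap₁₂

/-- Unfolding lemma for the Koszul operator. [folklore] -/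
@[simp]
theorem koszulOp_apply (T : E →L[ℝ] E →L[ℝ] E →L[ℝ] ℝ) (X Y Z : E) :
    koszulOp T X Y Z = T X Y Z + T Y Z X - T Z X Y := rfl

/-- The **Koszul form** of the components at `x` as a trilinear map:
`K(X, Y, Z) = ∂_X G(Y, Z) + ∂_Y G(Z, X) − ∂_Z G(X, Y)` (`= 2 G(Γ(X,Y), Z)`), i.e. twice the
Christoffel symbols of the first kind; O'Neill 1983, Ch. 3, proof of Prop. 3.13 (the Koszul
formula on coordinate fields, all brackets vanishing). [cite: ONeill1983, Ch. 3, Prop. 3.13] -/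
def koszulCLM (x : E) : E →L[ℝ] E →L[ℝ] E →L[ℝ] ℝ :=
  koszulOp (fderiv ℝ G x)

/-- Unfolding lemma for the Koszul form: `K(X,Y,Z) = ∂_X G(Y,Z) + ∂_Y G(Z,X) − ∂_Z G(X,Y)`. [folklore] -/
@[simp]
theorem koszulCLM_apply (x X Y Z : E) :
    koszulCLM G x X Y Z = fderiv ℝ G x X Y Z + fderiv ℝ G x Y Z X - fderiv ℝ G x Z X Y := rfl

/-- The **Christoffel map** of the components at `x`: the bilinear map
`Γ_x(X, Y) = ♯(½ K(X, Y, ·)) ∈ E`, i.e. `Γ(∂_i, ∂_j) = Γ^k_{ij} ∂_k`,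
`Γ^k_{ij} = ½ g^{km}(∂_i g_{jm} + ∂_j g_{im} − ∂_m g_{ij})` (O'Neill 1983, Ch. 3, Def. 3.12 and
Prop. 3.13: `D_{∂_i} ∂_j = Σ_k Γ^k_{ij} ∂_k`). As an element of `E →L E →L E`; the endomorphism
`chrAt G x X = Γ(X, ·)` is the covariant derivative `∇_X` acting on constant fields.
[cite: ONeill1983, Ch. 3, Prop. 3.13] -/
def chrAt (x : E) : E →L[ℝ] E →L[ℝ] E :=
  (2⁻¹ : ℝ) • ((ContinuousLinearMap.compL ℝ E (E →L[ℝ] ℝ) E (sharpAt G x)).comp (koszulCLM G x))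

/-- Unfolding lemma for the Christoffel map: `Γ(X,Y) = ½ ♯K(X,Y,·)`. [folklore] -/
theorem chrAt_apply (x X Y : E) :
    chrAt G x X Y = (2⁻¹ : ℝ) • sharpAt G x (koszulCLM G x X Y) := by
  simp [chrAt]

variable {G} {V : Set E} {x : E}

/-- **Defining property of the Christoffel map**: `2 G_x(Γ(X,Y), Z) = K(X,Y,Z)`
(O'Neill 1983, Ch. 3, proof of Prop. 3.13: `2⟨D_{∂_i}∂_j, ∂_m⟩ = ∂_i g_{jm} + ∂_j g_{im} − ∂_m g_{ij}`).
[cite: ONeill1983, Ch. 3, Prop. 3.13] -/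
theorem two_mul_apply_chrAt (hx : (G x).IsInvertible) (X Y Z : E) :
    2 * G x (chrAt G x X Y) Z = koszulCLM G x X Y Z := by
  rw [chrAt_apply, map_smul, smul_apply, apply_sharpAt_apply hx, smul_eq_mul]
  ring

/-- `G_x(Γ(X,Y), Z) = ½ K(X,Y,Z)`. [cite: ONeill1983, Ch. 3, Prop. 3.13] -/
theorem apply_chrAt (hx : (G x).IsInvertible) (X Y Z : E) :
    G x (chrAt G x X Y) Z = 2⁻¹ * koszulCLM G x X Y Z := by
  rw [← two_mul_apply_chrAt hx]; ring

/-- The Koszul form is symmetric in its first two slots when `DG(x)(v)` is symmetric.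
[folklore] -/
theorem koszulCLM_comm (hT : ∀ v Y Z : E, fderiv ℝ G x v Y Z = fderiv ℝ G x v Z Y) (X Y Z : E) :
    koszulCLM G x X Y Z = koszulCLM G x Y X Z := by
  simp only [koszulCLM_apply]
  rw [hT X Y Z, hT Y Z X, hT Z X Y]
  ring

/-- **The Christoffel map is symmetric** (the connection is torsion-free and coordinate fields
commute): `Γ(X,Y) = Γ(Y,X)`, i.e. `Γ^k_{ij} = Γ^k_{ji}` (O'Neill 1983, Ch. 3, Prop. 3.13 (3)).
[cite: ONeill1983, Ch. 3, Prop. 3.13] -/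
theorem IsMetricOn.chrAt_comm (hG : IsMetricOn G V) (hx : x ∈ V) (X Y : E) :
    chrAt G x X Y = chrAt G x Y X := by
  rw [chrAt_apply, chrAt_apply]
  congr 2
  ext Z
  exact koszulCLM_comm (hG.fderiv_symm hx) X Y Z

/-- `K(X,Y,Z) + K(X,Z,Y) = 2 ∂_X G(Y,Z)`. [folklore] -/
theorem koszulCLM_add_swap (hT : ∀ v Y Z : E, fderiv ℝ G x v Y Z = fderiv ℝ G x v Z Y)
    (X Y Z : E) : koszulCLM G x X Y Z + koszulCLM G x X Z Y = 2 * fderiv ℝ G x X Y Z := by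
  simp only [koszulCLM_apply]
  rw [hT X Z Y, hT Z Y X, hT Y X Z]
  ring

/-- **Metric compatibility** of the Christoffel map: `∂_X G(Y,Z) = G(Γ(X,Y), Z) + G(Y, Γ(X,Z))`,
i.e. `∂_k g_{ij} = Γ_{kij} + Γ_{kji}` (O'Neill 1983, Ch. 3, Prop. 3.13 with Thm. 3.11 (D4)).
[cite: ONeill1983, Ch. 3, Prop. 3.13] -/
theorem IsMetricOn.fderiv_eq_chrAt (hG : IsMetricOn G V) (hx : x ∈ V) (X Y Z : E) :
    fderiv ℝ G x X Y Z = G x (chrAt G x X Y) Z + G x Y (chrAt G x X Z) := by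
  have hi := hG.isInvertible x hx
  rw [hG.symm x hx Y (chrAt G x X Z), apply_chrAt hi, apply_chrAt hi]
  have h := koszulCLM_add_swap (hG.fderiv_symm hx) X Y Z
  linarith

/-! #### Smoothness of `K` and `Γ` -/

/-- The Koszul form `x ↦ K_x` is `C^∞` on `V`. [folklore] -/
theorem IsMetricOn.contDiffOn_koszulCLM (hG : IsMetricOn G V) : ContDiffOn ℝ ∞ (koszulCLM G) V :=
  koszulOp.contDiff.comp_contDiffOn hG.contDiffOn_fderiv

/-- **The derivative of the Koszul form is the Koszul operator of `D²G`**: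
`D K(x)(v) = koszulOp (D²G(x)(v))`. [folklore] -/
theorem IsMetricOn.hasFDerivAt_koszulCLM (hG : IsMetricOn G V) (hx : x ∈ V) :
    HasFDerivAt (koszulCLM G) (koszulOp.comp (fderiv ℝ (fderiv ℝ G) x)) x :=
  koszulOp.hasFDerivAt.comp x (hG.differentiableAt_fderiv hx).hasFDerivAt

/-- `fderiv` form of `hasFDerivAt_koszulCLM`. [folklore] -/
theorem IsMetricOn.fderiv_koszulCLM (hG : IsMetricOn G V) (hx : x ∈ V) (v : E) :
    fderiv ℝ (koszulCLM G) x v = koszulOp (fderiv ℝ (fderiv ℝ G) x v) := by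
  rw [(hG.hasFDerivAt_koszulCLM hx).fderiv]
  rfl

/-- `∂_v K(·)(X,Y,Z) (x) = D²G(x)(v,X)(Y,Z) + D²G(x)(v,Y)(Z,X) − D²G(x)(v,Z)(X,Y)`. [folklore] -/
theorem IsMetricOn.fderiv_koszulCLM_apply₃ (hG : IsMetricOn G V) (hx : x ∈ V) (X Y Z v : E) :
    fderiv ℝ (fun y ↦ koszulCLM G y X Y Z) x v =
      fderiv ℝ (fderiv ℝ G) x v X Y Z + fderiv ℝ (fderiv ℝ G) x v Y Z X
        - fderiv ℝ (fderiv ℝ G) x v Z X Y := by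
  have hD : DifferentiableAt ℝ (koszulCLM G) x := (hG.hasFDerivAt_koszulCLM hx).differentiableAt
  have h1 : DifferentiableAt ℝ (fun y ↦ koszulCLM G y X) x := differentiableAt_clm_apply_const hD X
  have h2 : DifferentiableAt ℝ (fun y ↦ koszulCLM G y X Y) x := differentiableAt_clm_apply_const h1 Y
  rw [fderiv_clm_apply_const h2 Z v, fderiv_clm_apply_const h1 Y v, fderiv_clm_apply_const hD X v,
    hG.fderiv_koszulCLM hx]
  rfl

/-- The components `y ↦ K_y(X,Y,Z)` of the Koszul form are differentiable on `V`. [folklore] -/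
theorem IsMetricOn.differentiableAt_koszulCLM_apply₃ (hG : IsMetricOn G V) (hx : x ∈ V)
    (X Y Z : E) : DifferentiableAt ℝ (fun y ↦ koszulCLM G y X Y Z) x := by
  have hD : DifferentiableAt ℝ (koszulCLM G) x := (hG.hasFDerivAt_koszulCLM hx).differentiableAt
  exact differentiableAt_clm_apply_const
    (differentiableAt_clm_apply_const (differentiableAt_clm_apply_const hD X) Y) Z

/-- The Christoffel map `x ↦ Γ_x` is `C^∞` on `V`. [folklore] -/
theorem IsMetricOn.contDiffOn_chrAt [CompleteSpace E] (hG : IsMetricOn G V) :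
    ContDiffOn ℝ ∞ (chrAt G) V := by
  have hA : ContDiffOn ℝ ∞
      (fun x ↦ ContinuousLinearMap.compL ℝ E (E →L[ℝ] ℝ) E (sharpAt G x)) V :=
    (ContinuousLinearMap.compL ℝ E (E →L[ℝ] ℝ) E).contDiff.comp_contDiffOn hG.contDiffOn_sharpAt
  have h := (hA.clm_comp hG.contDiffOn_koszulCLM).const_smul (2⁻¹ : ℝ)
  exact h

/-- The Christoffel map is `C^∞` at the points of `V`. [folklore] -/
theorem IsMetricOn.contDiffAt_chrAt [CompleteSpace E] (hG : IsMetricOn G V) (hx : x ∈ V) :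
    ContDiffAt ℝ ∞ (chrAt G) x :=
  (hG.contDiffOn_chrAt x hx).contDiffAt (hG.mem_nhds hx)

/-- The Christoffel map is differentiable at the points of `V`. [folklore] -/
theorem IsMetricOn.differentiableAt_chrAt [CompleteSpace E] (hG : IsMetricOn G V) (hx : x ∈ V) :
    DifferentiableAt ℝ (chrAt G) x :=
  (hG.contDiffAt_chrAt hx).differentiableAt (by simp)

/-- The Koszul form is `C^∞` at the points of `V`. [folklore] -/
theorem IsMetricOn.contDiffAt_koszulCLM (hG : IsMetricOn G V) (hx : x ∈ V) :
    ContDiffAt ℝ ∞ (koszulCLM G) x :=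
  (hG.contDiffOn_koszulCLM x hx).contDiffAt (hG.mem_nhds hx)

/-- The Koszul form is differentiable at the points of `V`. [folklore] -/
theorem IsMetricOn.differentiableAt_koszulCLM (hG : IsMetricOn G V) (hx : x ∈ V) :
    DifferentiableAt ℝ (koszulCLM G) x :=
  (hG.contDiffAt_koszulCLM hx).differentiableAt (by simp)

/-- `∂_v (Γ(·)(X,Y))(x) = DΓ(x)(v)(X)(Y)`. [folklore] -/
theorem IsMetricOn.fderiv_chrAt_apply₂ [CompleteSpace E] (hG : IsMetricOn G V) (hx : x ∈ V)
    (X Y v : E) : fderiv ℝ (fun y ↦ chrAt G y X Y) x v = fderiv ℝ (chrAt G) x v X Y := by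
  have h1 : DifferentiableAt ℝ (fun y ↦ chrAt G y X) x :=
    differentiableAt_clm_apply_const (hG.differentiableAt_chrAt hx) X
  rw [fderiv_clm_apply_const h1 Y v, fderiv_clm_apply_const (hG.differentiableAt_chrAt hx) X v]

/-- `∂_v (Γ(·)(X))(x) = DΓ(x)(v)(X)` (endomorphism-valued). [folklore] -/
theorem IsMetricOn.fderiv_chrAt_apply [CompleteSpace E] (hG : IsMetricOn G V) (hx : x ∈ V)
    (X v : E) : fderiv ℝ (fun y ↦ chrAt G y X) x v = fderiv ℝ (chrAt G) x v X :=
  fderiv_clm_apply_const (hG.differentiableAt_chrAt hx) X v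

/-- The derivative of the Christoffel map is symmetric in the two slots of `Γ`:
`DΓ(x)(v)(X)(Y) = DΓ(x)(v)(Y)(X)`. [folklore] -/
theorem IsMetricOn.fderiv_chrAt_comm [CompleteSpace E] (hG : IsMetricOn G V) (hx : x ∈ V)
    (v X Y : E) : fderiv ℝ (chrAt G) x v X Y = fderiv ℝ (chrAt G) x v Y X := by
  rw [← hG.fderiv_chrAt_apply₂ hx, ← hG.fderiv_chrAt_apply₂ hx]
  have heq : (fun y ↦ chrAt G y X Y) =ᶠ[𝓝 x] fun y ↦ chrAt G y Y X :=
    (hG.eventually_mem hx).mono fun y hy ↦ hG.chrAt_comm hy X Y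
  rw [heq.fderiv_eq]

end Christoffel

/-! ### The curvature endomorphism -/

section Curvature

variable (G : E → E →L[ℝ] E →L[ℝ] ℝ)

/-- The **curvature endomorphism** of the components at `x`:
`R_x(X, Y) = D_XΓ(Y, ·) − D_YΓ(X, ·) + Γ(X, Γ(Y, ·)) − Γ(Y, Γ(X, ·)) ∈ End E`, the curvature
`∇_X ∇_Y − ∇_Y ∇_X − ∇_{[X,Y]}` of the Levi-Civita connection on the constant fields `X, Y`
(whose bracket vanishes), i.e. `R^i_{jkl} = ∂_k Γ^i_{lj} − ∂_l Γ^i_{kj} + Γ^i_{km}Γ^m_{lj} − Γ^i_{lm}Γ^m_{kj}`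
up to the naming of slots (O'Neill 1983, Ch. 3, Lemma 3.38, with the sign convention
`R(X,Y) = [∇_X, ∇_Y] − ∇_{[X,Y]}` of `Literature.Geometry.Lorentzian.CovariantDerivative.curvature`;
O'Neill's `R_{XY}` is `−R(X,Y)`). [cite: ONeill1983, Ch. 3, Lemma 3.38] -/
def riemAt (x X Y : E) : E →L[ℝ] E :=
  fderiv ℝ (chrAt G) x X Y - fderiv ℝ (chrAt G) x Y X
    + (chrAt G x X).comp (chrAt G x Y) - (chrAt G x Y).comp (chrAt G x X)

/-- Unfolding lemma: `R(X,Y)Z = D_XΓ(Y,Z) − D_YΓ(X,Z) + Γ(X,Γ(Y,Z)) − Γ(Y,Γ(X,Z))`. [folklore] -/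
theorem riemAt_apply (x X Y Z : E) :
    riemAt G x X Y Z = fderiv ℝ (chrAt G) x X Y Z - fderiv ℝ (chrAt G) x Y X Z
      + chrAt G x X (chrAt G x Y Z) - chrAt G x Y (chrAt G x X Z) := rfl

/-- `R(Y, X) = −R(X, Y)`. [cite: ONeill1983, Ch. 3, Prop. 3.36 (1)] -/
theorem riemAt_swap (x X Y : E) : riemAt G x Y X = -riemAt G x X Y := by
  simp only [riemAt]; abel

/-- `R(X, X) = 0`. [folklore] -/
theorem riemAt_self (x X : E) : riemAt G x X X = 0 := by
  simp only [riemAt]; abel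

/-- `R(X,Y)` is additive in `X`. [folklore] -/
theorem riemAt_add_left (x X₁ X₂ Y : E) :
    riemAt G x (X₁ + X₂) Y = riemAt G x X₁ Y + riemAt G x X₂ Y := by
  simp only [riemAt, map_add, _root_.add_apply, ContinuousLinearMap.add_comp,
    ContinuousLinearMap.comp_add]
  abel

/-- `R(X,Y)` is homogeneous in `X`. [folklore] -/
theorem riemAt_smul_left (x : E) (c : ℝ) (X Y : E) :
    riemAt G x (c • X) Y = c • riemAt G x X Y := by
  simp only [riemAt, map_smul, _root_.smul_apply, ContinuousLinearMap.smul_comp,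
    ContinuousLinearMap.comp_smul, smul_sub, smul_add]

/-- `R(X,Y)` is additive in `Y`. [folklore] -/
theorem riemAt_add_right (x X Y₁ Y₂ : E) :
    riemAt G x X (Y₁ + Y₂) = riemAt G x X Y₁ + riemAt G x X Y₂ := by
  rw [riemAt_swap, riemAt_add_left, neg_add, ← riemAt_swap, ← riemAt_swap]

/-- `R(X,Y)` is homogeneous in `Y`. [folklore] -/
theorem riemAt_smul_right (x : E) (c : ℝ) (X Y : E) :
    riemAt G x X (c • Y) = c • riemAt G x X Y := by
  rw [riemAt_swap, riemAt_smul_left, ← smul_neg, ← riemAt_swap]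

/-- The endomorphism `X ↦ R(X, Y)Z` whose trace is the Ricci tensor. [cite: ONeill1983, Ch. 3, Lemma 3.52] -/
def ricciEndo (x Y Z : E) : E →ₗ[ℝ] E where
  toFun X := riemAt G x X Y Z
  map_add' X₁ X₂ := by rw [riemAt_add_left, _root_.add_apply]
  map_smul' c X := by rw [riemAt_smul_left, _root_.smul_apply, RingHom.id_apply]

/-- Unfolding lemma for `ricciEndo`. [folklore] -/
@[simp]
theorem ricciEndo_apply (x Y Z X : E) : ricciEndo G x Y Z X = riemAt G x X Y Z := rfl

/-- The Ricci tensor as a bare function `Ric(Y, Z) = tr (X ↦ R(X,Y)Z)`; prefer the bundled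
`ricAt`. [cite: ONeill1983, Ch. 3, Lemma 3.52] -/
def ricFun (x Y Z : E) : ℝ :=
  LinearMap.trace ℝ E (ricciEndo G x Y Z)

/-- `Ric(Y,Z)` is additive in `Y`. [folklore] -/
theorem ricFun_add_left (x Y₁ Y₂ Z : E) :
    ricFun G x (Y₁ + Y₂) Z = ricFun G x Y₁ Z + ricFun G x Y₂ Z := by
  simp only [ricFun, ← map_add]
  congr 1; ext X
  simp [riemAt_add_right]

/-- `Ric(Y,Z)` is homogeneous in `Y`. [folklore] -/
theorem ricFun_smul_left (x : E) (c : ℝ) (Y Z : E) :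
    ricFun G x (c • Y) Z = c * ricFun G x Y Z := by
  simp only [ricFun, ← smul_eq_mul, ← map_smul]
  congr 1; ext X
  simp [riemAt_smul_right]

/-- `Ric(Y,Z)` is additive in `Z`. [folklore] -/
theorem ricFun_add_right (x Y Z₁ Z₂ : E) :
    ricFun G x Y (Z₁ + Z₂) = ricFun G x Y Z₁ + ricFun G x Y Z₂ := by
  simp only [ricFun, ← map_add]
  congr 1; ext X
  simp

/-- `Ric(Y,Z)` is homogeneous in `Z`. [folklore] -/
theorem ricFun_smul_right (x : E) (c : ℝ) (Y Z : E) :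
    ricFun G x Y (c • Z) = c * ricFun G x Y Z := by
  simp only [ricFun, ← smul_eq_mul, ← map_smul]
  congr 1; ext X
  simp

/-- Bundle a bilinear real function on a finite-dimensional space as an element of
`E →L E →L ℝ` (all linear maps are continuous). [folklore] -/
def mkCLM₂ [FiniteDimensional ℝ E] (f : E → E → ℝ)
    (h₁ : ∀ Y₁ Y₂ Z, f (Y₁ + Y₂) Z = f Y₁ Z + f Y₂ Z) (h₂ : ∀ (c : ℝ) Y Z, f (c • Y) Z = c * f Y Z)
    (h₃ : ∀ Y Z₁ Z₂, f Y (Z₁ + Z₂) = f Y Z₁ + f Y Z₂) (h₄ : ∀ (c : ℝ) Y Z, f Y (c • Z) = c * f Y Z) :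
    E →L[ℝ] E →L[ℝ] ℝ :=
  LinearMap.toContinuousLinearMap
    ((LinearMap.toContinuousLinearMap : (E →ₗ[ℝ] ℝ) ≃ₗ[ℝ] (E →L[ℝ] ℝ)).toLinearMap ∘ₗ
      LinearMap.mk₂ ℝ f h₁ h₂ h₃ h₄)

/-- Unfolding lemma for `mkCLM₂`. [folklore] -/
@[simp]
theorem mkCLM₂_apply [FiniteDimensional ℝ E] (f : E → E → ℝ) (h₁ h₂ h₃ h₄) (Y Z : E) :
    mkCLM₂ f h₁ h₂ h₃ h₄ Y Z = f Y Z := rfl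

/-- The **Ricci form** of the components at `x`, as a bilinear map:
`Ric_x(Y, Z) = tr (X ↦ R_x(X, Y) Z)` (O'Neill 1983, Ch. 3, Lemma 3.52; Lee, *Riemannian Manifolds*,
(7.24); the convention of `Literature.Geometry.Lorentzian.CovariantDerivative.ricci`).
[cite: ONeill1983, Ch. 3, Lemma 3.52] -/
def ricAt [FiniteDimensional ℝ E] (x : E) : E →L[ℝ] E →L[ℝ] ℝ :=
  mkCLM₂ (ricFun G x) (ricFun_add_left G x) (ricFun_smul_left G x) (ricFun_add_right G x)
    (ricFun_smul_right G x)

/-- Unfolding lemma: `Ric(Y,Z) = tr (X ↦ R(X,Y)Z)`. [folklore] -/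
theorem ricAt_apply [FiniteDimensional ℝ E] (x Y Z : E) :
    ricAt G x Y Z = LinearMap.trace ℝ E (ricciEndo G x Y Z) := rfl

/-- The **metric trace** (contraction `g^{ij} β_{ij}`) of a bilinear form `β` at `x`:
`tr_G β = tr (♯ ∘ β)` (O'Neill 1983, Ch. 3, pp. 60–61 and Lemma 3.36; the definition of
`PseudoRiemannianMetric.trace`). [cite: ONeill1983, Ch. 3, pp. 60–61] -/
def mtrAt (x : E) (β : E →L[ℝ] E →L[ℝ] ℝ) : ℝ :=
  LinearMap.trace ℝ E (((sharpAt G x).comp β : E →L[ℝ] E) : E →ₗ[ℝ] E)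

/-- The metric trace is additive. [folklore] -/
theorem mtrAt_add (x : E) (β₁ β₂ : E →L[ℝ] E →L[ℝ] ℝ) :
    mtrAt G x (β₁ + β₂) = mtrAt G x β₁ + mtrAt G x β₂ := by
  simp only [mtrAt, ContinuousLinearMap.comp_add, ContinuousLinearMap.toLinearMap_add, map_add]

/-- The metric trace is homogeneous. [folklore] -/
theorem mtrAt_smul (x : E) (c : ℝ) (β : E →L[ℝ] E →L[ℝ] ℝ) :
    mtrAt G x (c • β) = c * mtrAt G x β := by
  simp only [mtrAt, ContinuousLinearMap.comp_smul, ContinuousLinearMap.toLinearMap_smul, map_smul,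
    smul_eq_mul]

/-- The metric trace of `−β`. [folklore] -/
theorem mtrAt_neg (x : E) (β : E →L[ℝ] E →L[ℝ] ℝ) : mtrAt G x (-β) = -mtrAt G x β := by
  simp only [mtrAt, ContinuousLinearMap.comp_neg, ContinuousLinearMap.toLinearMap_neg, map_neg]

/-- The metric trace of a difference. [folklore] -/
theorem mtrAt_sub (x : E) (β₁ β₂ : E →L[ℝ] E →L[ℝ] ℝ) :
    mtrAt G x (β₁ - β₂) = mtrAt G x β₁ - mtrAt G x β₂ := by
  rw [sub_eq_add_neg, mtrAt_add, mtrAt_neg, ← sub_eq_add_neg]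

/-- The **scalar curvature** of the components at `x`: `S = tr_G Ric = g^{ij} Ric_{ij}`
(O'Neill 1983, Ch. 3, Def. 3.53; the definition of `PseudoRiemannianMetric.scalarCurvature`).
[cite: ONeill1983, Ch. 3, Def. 3.53] -/
def scalAt [FiniteDimensional ℝ E] (x : E) : ℝ :=
  mtrAt G x (ricAt G x)

/-- The **metric square norm** `|β|²_G = g^{ik} g^{jl} β_{ij} β_{kl} = tr ((♯∘β) ∘ (♯∘βᵗ))` of a
bilinear form at `x` (the definition of `PseudoRiemannianMetric.normSq`).
[cite: ONeill1983, Ch. 3, pp. 60–61] -/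
def normSqAt (x : E) (β : E →L[ℝ] E →L[ℝ] ℝ) : ℝ :=
  LinearMap.trace ℝ E
    ((((sharpAt G x).comp β).comp ((sharpAt G x).comp β.flip) : E →L[ℝ] E) : E →ₗ[ℝ] E)

end Curvature

/-! ### Basis formulas: `♯`, traces and the Ricci tensor in coordinates -/

section BasisFormulas

variable {ι : Type*} [Fintype ι] [FiniteDimensional ℝ E]
  (G : E → E →L[ℝ] E →L[ℝ] ℝ) (b : Basis ι ℝ E)

/-- The coordinate functionals of the basis as continuous linear maps. [folklore] -/
def coordCLM (i : ι) : E →L[ℝ] ℝ :=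
  LinearMap.toContinuousLinearMap (b.coord i)

omit [Fintype ι] in
/-- Unfolding lemma for `coordCLM`. [folklore] -/
@[simp]
theorem coordCLM_apply (i : ι) (v : E) : coordCLM b i v = b.coord i v := rfl

/-- The **inverse metric coefficients** `g^{ij}(x) = bⁱ(♯ bʲ)` in the basis `b` (`bⁱ` the dual
basis). O'Neill 1983, Ch. 3, p. 60 and Lemma 3.4. [cite: ONeill1983, Ch. 3, p. 60] -/
def ginv (x : E) (i j : ι) : ℝ :=
  b.coord i (sharpAt G x (coordCLM b j))

omit [FiniteDimensional ℝ E] in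
/-- The trace of an endomorphism in a basis: `tr f = Σᵢ bⁱ(f bᵢ)`. [folklore] -/
theorem trace_eq_sum_coord (f : E →ₗ[ℝ] E) :
    LinearMap.trace ℝ E f = ∑ i, b.coord i (f (b i)) := by
  classical
  rw [LinearMap.trace_eq_matrix_trace ℝ b, Matrix.trace]
  refine Finset.sum_congr rfl fun i _ ↦ ?_
  rw [Matrix.diag_apply, LinearMap.toMatrix_apply, Basis.coord_apply]

/-- A functional is the combination of the dual basis with its values: `α = Σⱼ α(bⱼ) bʲ`.
[folklore] -/
theorem eq_sum_smul_coordCLM (α : E →L[ℝ] ℝ) : α = ∑ j, α (b j) • coordCLM b j := by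
  ext w
  simp only [FunLike.coe_sum, Finset.sum_apply, _root_.smul_apply,
    coordCLM_apply, smul_eq_mul]
  conv_lhs => rw [← b.sum_repr w]
  rw [map_sum]
  refine Finset.sum_congr rfl fun j _ ↦ ?_
  rw [map_smul, smul_eq_mul, mul_comm, Basis.coord_apply]

variable {G} {V : Set E} {x : E}

/-- **Index raising in a basis**: `bⁱ(♯α) = Σⱼ g^{ij} α(bⱼ)`. [cite: ONeill1983, Ch. 3, p. 60] -/
theorem coord_sharpAt_eq_sum (α : E →L[ℝ] ℝ) (i : ι) :
    b.coord i (sharpAt G x α) = ∑ j, ginv G b x i j * α (b j) := by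
  conv_lhs => rw [eq_sum_smul_coordCLM b α]
  rw [map_sum, map_sum]
  refine Finset.sum_congr rfl fun j _ ↦ ?_
  rw [map_smul, map_smul, smul_eq_mul, mul_comm, ginv]

/-- **Components of a vector through the metric**: `bⁱ(v) = Σⱼ g^{ij} G(v, bⱼ)` (`♯ ∘ ♭ = id` in
the basis). [cite: ONeill1983, Ch. 3, p. 60] -/
theorem coord_eq_sum_ginv (hx : (G x).IsInvertible) (v : E) (i : ι) :
    b.coord i v = ∑ j, ginv G b x i j * G x v (b j) := by
  rw [← coord_sharpAt_eq_sum b (G x v) i, sharpAt_apply hx]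

omit [Fintype ι] in
/-- The inverse metric coefficients of a symmetric `G x` are symmetric: `g^{ij} = g^{ji}`.
[cite: ONeill1983, Ch. 3, Lemma 3.4] -/
theorem ginv_comm (hx : (G x).IsInvertible) (hs : ∀ v w : E, G x v w = G x w v) (i j : ι) :
    ginv G b x i j = ginv G b x j i := by
  simp only [ginv]
  rw [← coordCLM_apply b i, ← coordCLM_apply b j,
    ← apply_sharpAt_apply hx (coordCLM b i) (sharpAt G x (coordCLM b j)),
    ← apply_sharpAt_apply hx (coordCLM b j) (sharpAt G x (coordCLM b i)), hs]

/-- **The metric trace in a basis**: `tr_G β = Σᵢⱼ g^{ij} β(bᵢ, bⱼ)` (O'Neill 1983, Ch. 3,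
pp. 60–61: `C(β) = g^{ij} β_{ij}`). [cite: ONeill1983, Ch. 3, pp. 60–61] -/
theorem mtrAt_eq_sum (β : E →L[ℝ] E →L[ℝ] ℝ) :
    mtrAt G x β = ∑ i, ∑ j, ginv G b x i j * β (b i) (b j) := by
  rw [mtrAt, trace_eq_sum_coord b]
  refine Finset.sum_congr rfl fun i _ ↦ ?_
  rw [ContinuousLinearMap.coe_coe, ContinuousLinearMap.comp_apply, coord_sharpAt_eq_sum]

/-- **The trace of an endomorphism through the metric**: `tr f = Σᵢⱼ g^{ij} G(f bᵢ, bⱼ)`.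
[cite: ONeill1983, Ch. 3, pp. 60–61] -/
theorem trace_eq_sum_ginv (hx : (G x).IsInvertible) (f : E →ₗ[ℝ] E) :
    LinearMap.trace ℝ E f = ∑ i, ∑ j, ginv G b x i j * G x (f (b i)) (b j) := by
  rw [trace_eq_sum_coord b]
  exact Finset.sum_congr rfl fun i _ ↦ coord_eq_sum_ginv b hx _ i

/-- **The Ricci tensor in a basis**, trace form: `Ric(Y,Z) = Σᵢ bⁱ(R(bᵢ, Y)Z)`.
[cite: ONeill1983, Ch. 3, Lemma 3.52] -/
theorem ricAt_eq_sum_coord (Y Z : E) :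
    ricAt G x Y Z = ∑ i, b.coord i (riemAt G x (b i) Y Z) := by
  rw [ricAt_apply, trace_eq_sum_coord b]
  rfl

/-- **The Ricci tensor in a basis**, metric form: `Ric(Y,Z) = Σᵢⱼ g^{ij} G(R(bᵢ, Y)Z, bⱼ)`
(O'Neill 1983, Ch. 3, Lemma 3.52: `Ric = C¹₃ R`). [cite: ONeill1983, Ch. 3, Lemma 3.52] -/
theorem ricAt_eq_sum_ginv (hx : (G x).IsInvertible) (Y Z : E) :
    ricAt G x Y Z = ∑ i, ∑ j, ginv G b x i j * G x (riemAt G x (b i) Y Z) (b j) := by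
  rw [ricAt_apply, trace_eq_sum_ginv b hx]
  rfl

/-- **The scalar curvature in a basis**: `S = Σₖₗ g^{kl} Ric(bₖ, bₗ)`.
[cite: ONeill1983, Ch. 3, Def. 3.53] -/
theorem scalAt_eq_sum : scalAt G x = ∑ k, ∑ l, ginv G b x k l * ricAt G x (b k) (b l) :=
  mtrAt_eq_sum b (ricAt G x)

end BasisFormulas

/-! ### The curvature tensor paired with the metric and its symmetries -/

section Symmetries

variable [CompleteSpace E] {G : E → E →L[ℝ] E →L[ℝ] ℝ} {V : Set E} {x : E}

/-- `G(D_vΓ(X,Y), W) = ½ ∂_v K(X,Y,W) − DG(v)(Γ(X,Y), W)`: differentiate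
`G(Γ(X,Y), W) = ½ K(X,Y,W)` along `v`. [folklore] -/
theorem IsMetricOn.apply_fderiv_chrAt (hG : IsMetricOn G V) (hx : x ∈ V) (v X Y W : E) :
    G x (fderiv ℝ (chrAt G) x v X Y) W =
      2⁻¹ * fderiv ℝ (fun y ↦ koszulCLM G y X Y W) x v - fderiv ℝ G x v (chrAt G x X Y) W := by
  -- the product `y ↦ G y (Γ_y(X,Y))`, applied to `W`
  set c : E → E := fun y ↦ chrAt G y X Y with hc
  have hcd : HasFDerivAt c ((fderiv ℝ (chrAt G) x).flip X |>.flip Y) x := by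
    have h1 := hasFDerivAt_clm_apply_const (hG.differentiableAt_chrAt hx).hasFDerivAt X
    have h2 := hasFDerivAt_clm_apply_const h1 Y
    exact h2
  have hprod : HasFDerivAt (fun y ↦ G y (c y))
      ((G x).comp ((fderiv ℝ (chrAt G) x).flip X |>.flip Y) + (fderiv ℝ G x).flip (c x)) x :=
    (hG.differentiableAt hx).hasFDerivAt.clm_apply hcd
  have hW := hasFDerivAt_clm_apply_const hprod W
  have hval : fderiv ℝ (fun y ↦ G y (c y) W) x v =
      G x (fderiv ℝ (chrAt G) x v X Y) W + fderiv ℝ G x v (chrAt G x X Y) W := by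
    rw [hW.fderiv]
    rfl
  -- the same function is `½ K(X,Y,W)` near `x`
  have heq : (fun y ↦ G y (c y) W) =ᶠ[𝓝 x] fun y ↦ 2⁻¹ * koszulCLM G y X Y W :=
    (hG.eventually_mem hx).mono fun y hy ↦ apply_chrAt (hG.isInvertible y hy) X Y W
  have hval' : fderiv ℝ (fun y ↦ G y (c y) W) x v = 2⁻¹ * fderiv ℝ (fun y ↦ koszulCLM G y X Y W) x v := by
    rw [heq.fderiv_eq, fderiv_const_mul (hG.differentiableAt_koszulCLM_apply₃ hx X Y W)]
    rfl
  linarith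

/-- **The curvature tensor in first-kind form** (O'Neill 1983, Ch. 3, Lemma 3.38 paired with the
metric): `G(R(X,Y)Z, W) = ½ (∂_X K(Y,Z,W) − ∂_Y K(X,Z,W)) − G(Γ(Y,Z), Γ(X,W)) + G(Γ(X,Z), Γ(Y,W))`,
which avoids derivatives of the inverse metric (the form of `OpensChart.val_riemann_eq`).
[cite: ONeill1983, Ch. 3, Lemma 3.38] -/
theorem IsMetricOn.apply_riemAt (hG : IsMetricOn G V) (hx : x ∈ V) (X Y Z W : E) :
    G x (riemAt G x X Y Z) W =
      2⁻¹ * (fderiv ℝ (fun y ↦ koszulCLM G y Y Z W) x X - fderiv ℝ (fun y ↦ koszulCLM G y X Z W) x Y)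
        - G x (chrAt G x Y Z) (chrAt G x X W) + G x (chrAt G x X Z) (chrAt G x Y W) := by
  rw [riemAt_apply, map_sub, map_add, map_sub, _root_.sub_apply,
    _root_.add_apply, _root_.sub_apply,
    hG.apply_fderiv_chrAt hx X Y Z W, hG.apply_fderiv_chrAt hx Y X Z W,
    hG.fderiv_eq_chrAt hx X (chrAt G x Y Z) W, hG.fderiv_eq_chrAt hx Y (chrAt G x X Z) W,
    hG.symm x hx (chrAt G x Y Z) (chrAt G x X W), hG.symm x hx (chrAt G x X Z) (chrAt G x Y W)]
  ring

/-- **Skew-adjointness of the curvature endomorphism**: `G(R(X,Y)Z, W) = −G(R(X,Y)W, Z)`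
(O'Neill 1983, Ch. 3, Prop. 3.36 (2)); from the first-kind form, `K(Y,Z,W) + K(Y,W,Z) = 2∂_Y G(Z,W)`
and the symmetry of second derivatives of `G`. [cite: ONeill1983, Ch. 3, Prop. 3.36 (2)] -/
theorem IsMetricOn.apply_riemAt_swap (hG : IsMetricOn G V) (hx : x ∈ V) (X Y Z W : E) :
    G x (riemAt G x X Y W) Z = -G x (riemAt G x X Y Z) W := by
  rw [hG.apply_riemAt hx X Y Z W, hG.apply_riemAt hx X Y W Z,
    hG.fderiv_koszulCLM_apply₃ hx, hG.fderiv_koszulCLM_apply₃ hx, hG.fderiv_koszulCLM_apply₃ hx,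
    hG.fderiv_koszulCLM_apply₃ hx]
  have hs := hG.symm x hx
  have h2 := hG.fderiv_fderiv_symm hx
  have hc := hG.fderiv_fderiv_comm hx X Y
  rw [hs (chrAt G x Y W) (chrAt G x X Z), hs (chrAt G x X W) (chrAt G x Y Z),
    h2 X Z W Y, h2 X W Y Z, h2 Y Z W X, h2 Y W X Z, h2 X Y W Z, h2 Y X W Z, hc]
  ring

/-- **First Bianchi identity** for the curvature endomorphism of the components:
`R(X,Y)Z + R(Y,Z)X + R(Z,X)Y = 0` (O'Neill 1983, Ch. 3, Prop. 3.36 (3)); by torsion-freeness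
`Γ(X,Y) = Γ(Y,X)` and its derivative. [cite: ONeill1983, Ch. 3, Prop. 3.36 (3)] -/
theorem IsMetricOn.riemAt_cyclic (hG : IsMetricOn G V) (hx : x ∈ V) (X Y Z : E) :
    riemAt G x X Y Z + riemAt G x Y Z X + riemAt G x Z X Y = 0 := by
  simp only [riemAt_apply]
  have hD := hG.fderiv_chrAt_comm hx
  have hc := hG.chrAt_comm hx
  rw [hD X Z Y, hD Y X Z, hD Z Y X, hc Z Y, hc X Z, hc Y X]
  abel

/-- First Bianchi identity paired with a fourth vector. [cite: ONeill1983, Ch. 3, Prop. 3.36 (3)] -/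
theorem IsMetricOn.apply_riemAt_cyclic (hG : IsMetricOn G V) (hx : x ∈ V) (X Y Z W : E) :
    G x (riemAt G x X Y Z) W + G x (riemAt G x Y Z X) W + G x (riemAt G x Z X Y) W = 0 := by
  rw [← _root_.add_apply, ← _root_.add_apply, ← map_add, ← map_add,
    hG.riemAt_cyclic hx, map_zero, _root_.zero_apply]

omit [NormedAddCommGroup E] [NormedSpace ℝ E] [CompleteSpace E] in
/-- Algebra: a 4-argument real function which is skew in its first pair and in its last pair and
satisfies the first Bianchi identity is symmetric under exchange of the pairs (O'Neill 1983,
Ch. 3, proof of Prop. 3.36 (4)). [cite: ONeill1983, Ch. 3, Prop. 3.36 (4)] -/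
theorem pair_comm_of_skew_of_cyclic (R : E → E → E → E → ℝ)
    (h₁ : ∀ X Y Z W, R Y X Z W = -R X Y Z W) (h₂ : ∀ X Y Z W, R X Y W Z = -R X Y Z W)
    (h₃ : ∀ X Y Z W, R X Y Z W + R Y Z X W + R Z X Y W = 0) (X Y Z W : E) :
    R X Y Z W = R Z W X Y := by
  have a1 := h₃ X Y Z W
  have a2 := h₃ Y Z W X
  have a3 := h₃ Z W X Y
  have a4 := h₃ W X Y Z
  have b1 := h₁ X Y Z W; have b2 := h₂ X Y Z W
  have b3 := h₁ Y Z X W; have b4 := h₂ Y Z X W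
  have b5 := h₁ Z X Y W; have b6 := h₂ Z X Y W
  have b7 := h₁ Y Z W X; have b8 := h₂ Y Z W X
  have b9 := h₁ Z W Y X; have b10 := h₂ Z W Y X
  have b11 := h₁ W Y Z X; have b12 := h₂ W Y Z X
  have b13 := h₁ Z W X Y; have b14 := h₂ Z W X Y
  have b15 := h₁ W X Z Y; have b16 := h₂ W X Z Y
  have b17 := h₁ X Z W Y; have b18 := h₂ X Z W Y
  have b19 := h₁ W X Y Z; have b20 := h₂ W X Y Z
  have b21 := h₁ X Y W Z; have b22 := h₂ X Y W Z
  have b23 := h₁ Y W X Z; have b24 := h₂ Y W X Z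
  have c1 := h₂ Y X W Z; have c2 := h₂ W Z Y X; have c3 := h₁ W Z X Y
  have c4 := h₂ X W Z Y; have c5 := h₁ X W Y Z; have c6 := h₂ Z Y X W
  linarith

/-- **Pair symmetry** of the curvature tensor of the components:
`G(R(X,Y)Z, W) = G(R(Z,W)X, Y)` (O'Neill 1983, Ch. 3, Prop. 3.36 (4)).
[cite: ONeill1983, Ch. 3, Prop. 3.36 (4)] -/
theorem IsMetricOn.apply_riemAt_pair_comm (hG : IsMetricOn G V) (hx : x ∈ V) (X Y Z W : E) :
    G x (riemAt G x X Y Z) W = G x (riemAt G x Z W X) Y :=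
  pair_comm_of_skew_of_cyclic (fun X Y Z W ↦ G x (riemAt G x X Y Z) W)
    (fun X Y Z W ↦ by simp only [riemAt_swap G x X Y, _root_.neg_apply, map_neg])
    (fun X Y Z W ↦ hG.apply_riemAt_swap hx X Y Z W)
    (fun X Y Z W ↦ hG.apply_riemAt_cyclic hx X Y Z W) X Y Z W

variable [FiniteDimensional ℝ E]

/-- **The Ricci tensor is symmetric** (O'Neill 1983, Ch. 3, Lemma 3.52), from pair symmetry and
the basis formula `Ric(Y,Z) = Σ g^{ij} G(R(bᵢ,Y)Z, bⱼ)`. [cite: ONeill1983, Ch. 3, Lemma 3.52] -/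
theorem IsMetricOn.ricAt_comm (hG : IsMetricOn G V) (hx : x ∈ V) (Y Z : E) :
    ricAt G x Y Z = ricAt G x Z Y := by
  set b := Module.finBasis ℝ E
  have hi := hG.isInvertible x hx
  rw [ricAt_eq_sum_ginv b hi, ricAt_eq_sum_ginv b hi, Finset.sum_comm]
  refine Finset.sum_congr rfl fun j _ ↦ Finset.sum_congr rfl fun i _ ↦ ?_
  rw [ginv_comm b hi (hG.symm x hx) i j, hG.apply_riemAt_pair_comm hx (b i) Y Z (b j),
    hG.apply_riemAt_swap hx Z (b j) Y (b i), riemAt_swap, _root_.neg_apply, map_neg,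
    _root_.neg_apply, neg_neg]

end Symmetries

/-! ### The trace as a continuous linear map; smoothness of the curvature objects -/

section Smoothness

variable [FiniteDimensional ℝ E]

variable (E) in
/-- The trace of a continuous endomorphism, as a continuous linear functional on `E →L E`
(finite dimension). [folklore] -/
def traceCLM : (E →L[ℝ] E) →L[ℝ] ℝ :=
  LinearMap.toContinuousLinearMap (LinearMap.trace ℝ E ∘ₗ ContinuousLinearMap.coeLM ℝ)

/-- Unfolding lemma for `traceCLM`. [folklore] -/
@[simp]
theorem traceCLM_apply (f : E →L[ℝ] E) : traceCLM E f = LinearMap.trace ℝ E (f : E →ₗ[ℝ] E) := rfl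

variable (G : E → E →L[ℝ] E →L[ℝ] ℝ)

/-- The metric trace through `traceCLM`: `tr_G β = tr (♯ ∘ β)`. [folklore] -/
theorem mtrAt_eq_traceCLM (x : E) (β : E →L[ℝ] E →L[ℝ] ℝ) :
    mtrAt G x β = traceCLM E ((sharpAt G x).comp β) := rfl

/-- The metric square norm through `traceCLM`. [folklore] -/
theorem normSqAt_eq_traceCLM (x : E) (β : E →L[ℝ] E →L[ℝ] ℝ) :
    normSqAt G x β = traceCLM E (((sharpAt G x).comp β).comp ((sharpAt G x).comp β.flip)) := rfl

variable {G} {V : Set E} {x : E} [CompleteSpace E]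

omit [FiniteDimensional ℝ E] in
/-- `x ↦ R_x(X, Y)` is `C^∞` on `V`. [folklore] -/
theorem IsMetricOn.contDiffOn_riemAt (hG : IsMetricOn G V) (X Y : E) :
    ContDiffOn ℝ ∞ (fun x ↦ riemAt G x X Y) V := by
  have hD : ContDiffOn ℝ ∞ (fderiv ℝ (chrAt G)) V :=
    hG.contDiffOn_chrAt.fderiv_of_isOpen hG.isOpen (by simp)
  have h1 : ∀ A B : E, ContDiffOn ℝ ∞ (fun x ↦ fderiv ℝ (chrAt G) x A B) V := fun A B ↦
    (hD.clm_apply contDiffOn_const).clm_apply contDiffOn_const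
  have h2 : ∀ A : E, ContDiffOn ℝ ∞ (fun x ↦ chrAt G x A) V := fun A ↦
    hG.contDiffOn_chrAt.clm_apply contDiffOn_const
  unfold riemAt
  exact (((h1 X Y).sub (h1 Y X)).add ((h2 X).clm_comp (h2 Y))).sub ((h2 Y).clm_comp (h2 X))

omit [FiniteDimensional ℝ E] in
/-- `x ↦ R_x(X,Y)Z` is `C^∞` on `V`. [folklore] -/
theorem IsMetricOn.contDiffOn_riemAt_apply (hG : IsMetricOn G V) (X Y Z : E) :
    ContDiffOn ℝ ∞ (fun x ↦ riemAt G x X Y Z) V :=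
  (hG.contDiffOn_riemAt X Y).clm_apply contDiffOn_const

omit [FiniteDimensional ℝ E] in
/-- `x ↦ R_x(X,Y)` is `C^∞` at the points of `V`. [folklore] -/
theorem IsMetricOn.contDiffAt_riemAt (hG : IsMetricOn G V) (hx : x ∈ V) (X Y : E) :
    ContDiffAt ℝ ∞ (fun x ↦ riemAt G x X Y) x :=
  (hG.contDiffOn_riemAt X Y x hx).contDiffAt (hG.mem_nhds hx)

omit [FiniteDimensional ℝ E] in
/-- `x ↦ R_x(X,Y)` is differentiable at the points of `V`. [folklore] -/
theorem IsMetricOn.differentiableAt_riemAt (hG : IsMetricOn G V) (hx : x ∈ V) (X Y : E) :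
    DifferentiableAt ℝ (fun x ↦ riemAt G x X Y) x :=
  (hG.contDiffAt_riemAt hx X Y).differentiableAt (by simp)

/-- The Ricci form `x ↦ Ric_x` is `C^∞` on `V` (as a map into `E →L E →L ℝ`). [folklore] -/
theorem IsMetricOn.contDiffOn_ricAt (hG : IsMetricOn G V) : ContDiffOn ℝ ∞ (ricAt G) V := by
  set b := Module.finBasis ℝ E
  refine contDiffOn_clm_apply.2 fun Y ↦ contDiffOn_clm_apply.2 fun Z ↦ ?_
  have heq : (fun x ↦ ricAt G x Y Z) = fun x ↦ ∑ i, coordCLM b i (riemAt G x (b i) Y Z) :=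
    funext fun x ↦ ricAt_eq_sum_coord b Y Z
  rw [heq]
  exact ContDiffOn.sum fun i _ ↦
    (coordCLM b i).contDiff.comp_contDiffOn (hG.contDiffOn_riemAt_apply (b i) Y Z)

/-- The Ricci form is `C^∞` at the points of `V`. [folklore] -/
theorem IsMetricOn.contDiffAt_ricAt (hG : IsMetricOn G V) (hx : x ∈ V) :
    ContDiffAt ℝ ∞ (ricAt G) x :=
  (hG.contDiffOn_ricAt x hx).contDiffAt (hG.mem_nhds hx)

/-- The Ricci form is differentiable at the points of `V`. [folklore] -/
theorem IsMetricOn.differentiableAt_ricAt (hG : IsMetricOn G V) (hx : x ∈ V) :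
    DifferentiableAt ℝ (ricAt G) x :=
  (hG.contDiffAt_ricAt hx).differentiableAt (by simp)

/-- The metric trace of a `C^∞` field of bilinear forms is `C^∞`. [folklore] -/
theorem IsMetricOn.contDiffOn_mtrAt (hG : IsMetricOn G V) {β : E → E →L[ℝ] E →L[ℝ] ℝ}
    (hβ : ContDiffOn ℝ ∞ β V) : ContDiffOn ℝ ∞ (fun x ↦ mtrAt G x (β x)) V := by
  simp only [mtrAt_eq_traceCLM]
  exact (traceCLM E).contDiff.comp_contDiffOn (hG.contDiffOn_sharpAt.clm_comp hβ)

/-- The metric square norm of a `C^∞` field of bilinear forms is `C^∞`. [folklore] -/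
theorem IsMetricOn.contDiffOn_normSqAt (hG : IsMetricOn G V) {β : E → E →L[ℝ] E →L[ℝ] ℝ}
    (hβ : ContDiffOn ℝ ∞ β V) : ContDiffOn ℝ ∞ (fun x ↦ normSqAt G x (β x)) V := by
  simp only [normSqAt_eq_traceCLM]
  have hflip : ContDiffOn ℝ ∞ (fun x ↦ (β x).flip) V :=
    (ContinuousLinearMap.flipₗᵢ ℝ E E ℝ).contDiff.comp_contDiffOn hβ
  exact (traceCLM E).contDiff.comp_contDiffOn
    ((hG.contDiffOn_sharpAt.clm_comp hβ).clm_comp (hG.contDiffOn_sharpAt.clm_comp hflip))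

/-- **The scalar curvature of smooth components is smooth**: `x ↦ S(x)` is `C^∞` on `V`.
[folklore] -/
theorem IsMetricOn.contDiffOn_scalAt (hG : IsMetricOn G V) : ContDiffOn ℝ ∞ (scalAt G) V :=
  hG.contDiffOn_mtrAt hG.contDiffOn_ricAt

/-- The scalar curvature is `C^∞` at the points of `V`. [folklore] -/
theorem IsMetricOn.contDiffAt_scalAt (hG : IsMetricOn G V) (hx : x ∈ V) :
    ContDiffAt ℝ ∞ (scalAt G) x :=
  (hG.contDiffOn_scalAt x hx).contDiffAt (hG.mem_nhds hx)

/-- The inverse metric coefficients `x ↦ g^{ij}(x)` are `C^∞` on `V`. [folklore] -/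
theorem IsMetricOn.contDiffOn_ginv {ι : Type*} [Fintype ι] (hG : IsMetricOn G V) (b : Basis ι ℝ E)
    (i j : ι) : ContDiffOn ℝ ∞ (fun x ↦ ginv G b x i j) V :=
  (coordCLM b i).contDiff.comp_contDiffOn (hG.contDiffOn_sharpAt.clm_apply contDiffOn_const)

end Smoothness

end MetricCoord

end Literature.Geometry.Lorentzian

end
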